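import Mathlib.Analysis.Calculus.ContDiff.Basic
import Mathlib.Analysis.Calculus.ContDiff.RCLike
import Mathlib.Analysis.InnerProductSpace.PiL2
import Mathlib.Analysis.Normed.Module.FiniteDimension
import Mathlib.Topology.MetricSpace.ProperSpace
import HarnessLib

/-!
# Convexity near infinity of a conformally compact metric: uniform constants in a boundary chart

Support file (everything proved, no definitions, no named facts) for the discharge of
`Literature.Geometry.Riemannian.ggsu_boundary_sphere_of_nonTrapping_of_nonpos`
(`SimpleAHBoundarySphere.lean`; Graham–Guillarmou–Stefanov–Uhlmann, Ann. Inst. Fourier 69 (2019),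
p. 10). Pure finite-dimensional calculus: given, on a set `S` of unique differentiability
(the target of a boundary chart) near a point `x₀ ∈ S`, a `C²` function `r` (the boundary defining
function read in the chart) and a `C¹` field of positive definite bilinear forms `Q` (the
compactified metric read in the chart) with `Q_{x₀}(ν, ν) = 1 = Dr_{x₀}(ν)` for some vector `ν`
(the unit normal), this file produces a radius `δ > 0` and constants `m, C₁, C₂, C_r, c₀ > 0` such
that at every interior point of `S` within distance `δ` of `x₀` the hypotheses of the pointwise
convexity estimate `SimpleAH.hessTerm_sub_christoffel_neg` (`AHChartConvexity.lean`) hold: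
`m ‖w‖² ≤ Q(w, w)`, `‖DQ‖ ≤ C₁`, `‖D²r‖ ≤ C₂`, `‖Dr‖ ≤ C_r`, `c₀ Q(ν, ν) ≤ Dr(ν)²`
(`exists_chart_constants`; continuity and compactness).

## References

* C. R. Graham, C. Guillarmou, P. Stefanov, G. Uhlmann, Ann. Inst. Fourier 69 (2019), p. 10.
  [GrahamEtAl2020]
-/

noncomputable section

open Set Filter Function Metric
open scoped Topology ContDiff

namespace Literature.Geometry.Riemannian

namespace SimpleAH

set_option maxSynthPendingDepth 3

variable {E : Type*} [NormedAddCommGroup E] [NormedSpace ℝ E] [FiniteDimensional ℝ E]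

/-- A positive definite continuous field of bilinear forms on a compact set is uniformly
elliptic: `m ‖w‖² ≤ Q_x(w, w)` for one `m > 0`. [folklore] -/
theorem exists_ellipticity_of_isCompact {K : Set E} (hK : IsCompact K)
    {Q : E → E →L[ℝ] E →L[ℝ] ℝ} (hQ : ContinuousOn Q K)
    (hpos : ∀ x ∈ K, ∀ a : E, a ≠ 0 → 0 < Q x a a) :
    ∃ m : ℝ, 0 < m ∧ ∀ x ∈ K, ∀ w : E, m * ‖w‖ ^ 2 ≤ Q x w w := by
  set Φ : E × E → ℝ := fun p ↦ Q p.1 p.2 p.2 with hΦ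
  have hΦc : ContinuousOn Φ (K ×ˢ univ) := by
    have h1 : ContinuousOn (fun p : E × E ↦ Q p.1) (K ×ˢ univ) :=
      hQ.comp continuous_fst.continuousOn fun p hp ↦ hp.1
    have h2 : ContinuousOn (fun p : E × E ↦ Q p.1 p.2) (K ×ˢ univ) :=
      h1.clm_apply continuous_snd.continuousOn
    exact h2.clm_apply continuous_snd.continuousOn
  have hKc : IsCompact (K ×ˢ sphere (0 : E) 1) := hK.prod (isCompact_sphere 0 1)
  obtain ⟨m, hm, hmΦ⟩ : ∃ m : ℝ, 0 < m ∧ ∀ p ∈ K ×ˢ sphere (0 : E) 1, m ≤ Φ p := by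
    by_cases hne : (K ×ˢ sphere (0 : E) 1).Nonempty
    · obtain ⟨p₀, hp₀, hmin⟩ :=
        hKc.exists_isMinOn hne (hΦc.mono (prod_mono Subset.rfl (subset_univ _)))
      refine ⟨Φ p₀, ?_, fun p hp ↦ hmin hp⟩
      have hp₀2 : p₀.2 ≠ 0 := by
        intro h0
        have : ‖p₀.2‖ = 1 := by simpa using hp₀.2
        rw [h0, norm_zero] at this
        exact zero_ne_one this
      exact hpos _ hp₀.1 _ hp₀2
    · exact ⟨1, one_pos, fun p hp ↦ (hne ⟨p, hp⟩).elim⟩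
  refine ⟨m, hm, fun x hx w ↦ ?_⟩
  by_cases hw : w = 0
  · subst hw; simp
  have hwpos : 0 < ‖w‖ := norm_pos_iff.2 hw
  set u : E := ‖w‖⁻¹ • w with hu
  have hun : u ∈ sphere (0 : E) 1 := by
    rw [mem_sphere_zero_iff_norm, hu, norm_smul, norm_inv, norm_norm, inv_mul_cancel₀ hwpos.ne']
  have hwu : w = ‖w‖ • u := by rw [hu, smul_smul, mul_inv_cancel₀ hwpos.ne', one_smul]
  have h1 : m ≤ Q x u u := hmΦ (x, u) ⟨hx, hun⟩
  have h2 : Q x w w = ‖w‖ ^ 2 * Q x u u := by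
    conv_lhs => rw [hwu]
    simp only [map_smul, smul_apply, smul_eq_mul]
    ring
  rw [h2]
  calc m * ‖w‖ ^ 2 = ‖w‖ ^ 2 * m := mul_comm _ _
    _ ≤ ‖w‖ ^ 2 * Q x u u := mul_le_mul_of_nonneg_left h1 (sq_nonneg _)

/-- **Uniform constants for the convexity estimate in a boundary chart.** Let `S ⊆ C ⊆ E` with `C`
closed, `S` a set of unique differentiability which is a neighbourhood of `x₀ ∈ S` within `C`; let
`U ∋ x₀` be open, `r` of class `C²` and `Q` (bilinear-form valued) of class `C¹` on `S ∩ U`, with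
`Q_x` positive definite there, and `ν` a vector with `Q_{x₀}(ν, ν) = 1` and `D_S r(x₀)(ν) = 1`.
Then there are `δ > 0` and constants `m, c₀ > 0`, `C₁, C₂, C_r ≥ 0` such that at every point `x`
of the interior of `S` with `‖x - x₀‖ < δ`: `r` is differentiable near `x`, `Dr` and `Q` are
differentiable at `x`, `m ‖w‖² ≤ Q_x(w,w)`, `‖DQ(x)‖ ≤ C₁`, `‖D²r(x)‖ ≤ C₂`, `‖Dr(x)‖ ≤ C_r`,
`Q_x(ν,ν) > 0` and `c₀ Q_x(ν, ν) ≤ Dr_x(ν)²` (continuity on the compact pieces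
`closedBall x₀ δ ∩ C ⊆ S ∩ U`). [folklore] -/
theorem exists_chart_constants {S C U : Set E} (hC : IsClosed C) (hSC : S ⊆ C)
    (hS : UniqueDiffOn ℝ S) {x₀ : E} (hx₀ : x₀ ∈ S) (hSn : S ∈ 𝓝[C] x₀) (hU : IsOpen U)
    (hxU : x₀ ∈ U) {r : E → ℝ} (hr : ContDiffOn ℝ 2 r (S ∩ U))
    {Q : E → E →L[ℝ] E →L[ℝ] ℝ} (hQ : ContDiffOn ℝ 1 Q (S ∩ U))
    (hQpos : ∀ x ∈ S ∩ U, ∀ a : E, a ≠ 0 → 0 < Q x a a)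
    {ν : E} (hν1 : Q x₀ ν ν = 1) (hν2 : fderivWithin ℝ r S x₀ ν = 1) :
    ∃ δ m c₀ C₁ C₂ Cr : ℝ, 0 < δ ∧ 0 < m ∧ 0 < c₀ ∧ 0 ≤ C₁ ∧ 0 ≤ C₂ ∧ 0 ≤ Cr ∧
      ∀ x ∈ interior S ∩ ball x₀ δ,
        (∀ᶠ y in 𝓝 x, DifferentiableAt ℝ r y) ∧ DifferentiableAt ℝ (fderiv ℝ r) x ∧
        DifferentiableAt ℝ Q x ∧ (∀ w : E, m * ‖w‖ ^ 2 ≤ Q x w w) ∧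
        ‖fderiv ℝ Q x‖ ≤ C₁ ∧ ‖fderiv ℝ (fderiv ℝ r) x‖ ≤ C₂ ∧ ‖fderiv ℝ r x‖ ≤ Cr ∧
        0 < Q x ν ν ∧ c₀ * Q x ν ν ≤ (fderiv ℝ r x ν) ^ 2 := by
  -- the set `T = S ∩ U` of unique differentiability and the derivatives within it
  set T : Set E := S ∩ U with hT_def
  have hT : UniqueDiffOn ℝ T := hS.inter hU
  have hx₀T : x₀ ∈ T := ⟨hx₀, hxU⟩
  set r' : E → E →L[ℝ] ℝ := fderivWithin ℝ r T with hr'_def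
  set r'' : E → E →L[ℝ] E →L[ℝ] ℝ := fderivWithin ℝ r' T with hr''_def
  set Q' : E → E →L[ℝ] E →L[ℝ] E →L[ℝ] ℝ := fderivWithin ℝ Q T with hQ'_def
  have h12 : (1 : ℕ∞ω) + 1 ≤ 2 := by norm_num
  have hr1 : ContDiffOn ℝ 1 r' T := hr.fderivWithin hT h12
  have hrc : ContinuousOn r T := hr.continuousOn
  have hr'c : ContinuousOn r' T := hr.continuousOn_fderivWithin hT (by norm_num)
  have hr''c : ContinuousOn r'' T := hr1.continuousOn_fderivWithin hT le_rfl
  have hQc : ContinuousOn Q T := hQ.continuousOn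
  have hQ'c : ContinuousOn Q' T := hQ.continuousOn_fderivWithin hT le_rfl
  -- a compact piece `K = closedBall x₀ δ₁ ∩ C ⊆ T`
  have hTn : T ∈ 𝓝[C] x₀ := inter_mem hSn (mem_nhdsWithin_of_mem_nhds (hU.mem_nhds hxU))
  obtain ⟨δ₁, hδ₁, hδ₁T⟩ : ∃ δ₁ > 0, closedBall x₀ δ₁ ∩ C ⊆ T := by
    rcases (nhdsWithin_hasBasis nhds_basis_closedBall C).mem_iff.1 hTn with ⟨δ₁, hδ₁, h⟩
    exact ⟨δ₁, hδ₁, h⟩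
  set K : Set E := closedBall x₀ δ₁ ∩ C with hK_def
  have hKc : IsCompact K := (isCompact_closedBall x₀ δ₁).inter_right hC
  have hKT : K ⊆ T := hδ₁T
  have hx₀K : x₀ ∈ K := ⟨mem_closedBall_self hδ₁.le, hSC hx₀⟩
  -- sup bounds on `K`
  obtain ⟨C₁, hC₁⟩ := hKc.exists_bound_of_continuousOn (hQ'c.mono hKT)
  obtain ⟨C₂, hC₂⟩ := hKc.exists_bound_of_continuousOn (hr''c.mono hKT)
  obtain ⟨Cr, hCr⟩ := hKc.exists_bound_of_continuousOn (hr'c.mono hKT)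
  have hC₁0 : 0 ≤ C₁ := (norm_nonneg _).trans (hC₁ x₀ hx₀K)
  have hC₂0 : 0 ≤ C₂ := (norm_nonneg _).trans (hC₂ x₀ hx₀K)
  have hCr0 : 0 ≤ Cr := (norm_nonneg _).trans (hCr x₀ hx₀K)
  -- ellipticity on `K`
  obtain ⟨m, hm, hmQ⟩ := exists_ellipticity_of_isCompact hKc (hQc.mono hKT)
    (fun x hx a ha ↦ hQpos x (hKT hx) a ha)
  -- the lower bound `c₀ Q(ν, ν) ≤ Dr(ν)²` near `x₀`, `c₀ = 1/2`
  have hfd0 : r' x₀ ν = 1 := by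
    rw [hr'_def, hT_def, fderivWithin_inter (hU.mem_nhds hxU)]
    exact hν2
  have hh : ContinuousOn (fun x ↦ (r' x ν) ^ 2 - 2⁻¹ * Q x ν ν) T := by
    have h1 : ContinuousOn (fun x ↦ r' x ν) T := hr'c.clm_apply continuousOn_const
    have h2 : ContinuousOn (fun x ↦ Q x ν ν) T :=
      (hQc.clm_apply continuousOn_const).clm_apply continuousOn_const
    exact (h1.pow 2).sub (continuousOn_const.mul h2)
  have hh0 : 0 < (r' x₀ ν) ^ 2 - 2⁻¹ * Q x₀ ν ν := by
    rw [hfd0, hν1]; norm_num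
  obtain ⟨δ₂, hδ₂, hδ₂h⟩ : ∃ δ₂ > 0, ∀ x ∈ T, dist x x₀ < δ₂ →
      0 < (r' x ν) ^ 2 - 2⁻¹ * Q x ν ν := by
    have hc := hh x₀ hx₀T
    have hev := hc.eventually (Ioi_mem_nhds hh0)
    rcases Metric.mem_nhdsWithin_iff.1 hev with ⟨δ₂, hδ₂, h⟩
    exact ⟨δ₂, hδ₂, fun x hx hd ↦ h ⟨hd, hx⟩⟩
  -- the radius
  set δ : ℝ := min δ₁ δ₂ with hδ_def
  have hδ : 0 < δ := lt_min hδ₁ hδ₂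
  refine ⟨δ, m, 2⁻¹, C₁, C₂, Cr, hδ, hm, by norm_num, hC₁0, hC₂0, hCr0, fun x hx ↦ ?_⟩
  obtain ⟨hxi, hxb⟩ := hx
  have hxS : x ∈ S := interior_subset hxi
  have hxd : dist x x₀ < δ := mem_ball.1 hxb
  have hxK : x ∈ K := ⟨mem_closedBall.2 (hxd.le.trans (min_le_left _ _)), hSC hxS⟩
  have hxT : x ∈ T := hKT hxK
  -- `T` is a neighbourhood of `x`
  have hTx : T ∈ 𝓝 x := by
    have h1 : interior S ∈ 𝓝 x := isOpen_interior.mem_nhds hxi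
    have h2 : U ∈ 𝓝 x := hU.mem_nhds hxT.2
    exact Filter.mem_of_superset (inter_mem h1 h2) (inter_subset_inter_left _ interior_subset)
  -- `r` is differentiable near `x`, with `fderiv r = r'` near `x`
  have hev : ∀ᶠ y in 𝓝 x, T ∈ 𝓝 y := by
    rcases _root_.mem_nhds_iff.1 hTx with ⟨V, hVT, hVo, hxV⟩
    exact Filter.eventually_of_mem (hVo.mem_nhds hxV) fun y hy ↦
      Filter.mem_of_superset (hVo.mem_nhds hy) hVT
  have hrd : ∀ᶠ y in 𝓝 x, DifferentiableAt ℝ r y := by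
    filter_upwards [hev] with y hy
    exact ((hr y (mem_of_mem_nhds hy)).differentiableWithinAt (by norm_num)).differentiableAt hy
  have hreq : fderiv ℝ r =ᶠ[𝓝 x] r' := by
    filter_upwards [hev] with y hy
    rw [hr'_def, fderivWithin_of_mem_nhds hy]
  have hr'd : DifferentiableAt ℝ r' x :=
    ((hr1 x hxT).differentiableWithinAt one_ne_zero).differentiableAt hTx
  have hfr'd : DifferentiableAt ℝ (fderiv ℝ r) x := hreq.differentiableAt_iff.2 hr'd
  have hfr'eq : fderiv ℝ (fderiv ℝ r) x = r'' x := by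
    rw [hreq.fderiv_eq, hr''_def, fderivWithin_of_mem_nhds hTx]
  have hfreq : fderiv ℝ r x = r' x := hreq.self_of_nhds
  have hQd : DifferentiableAt ℝ Q x :=
    ((hQ x hxT).differentiableWithinAt one_ne_zero).differentiableAt hTx
  have hfQeq : fderiv ℝ Q x = Q' x := by rw [hQ'_def, fderivWithin_of_mem_nhds hTx]
  have hpos2 := hδ₂h x hxT (hxd.trans_le (min_le_right _ _))
  have hQν : 0 < Q x ν ν := by
    have hν0 : ν ≠ 0 := by
      intro h0; rw [h0] at hν1; simp at hν1
    exact hQpos x hxT ν hν0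
  refine ⟨hrd, hfr'd, hQd, fun w ↦ hmQ x hxK w, ?_, ?_, ?_, hQν, ?_⟩
  · rw [hfQeq]; exact hC₁ x hxK
  · rw [hfr'eq]; exact hC₂ x hxK
  · rw [hfreq]; exact hCr x hxK
  · rw [hfreq]; linarith

end SimpleAH

end Literature.Geometry.Riemannian

end
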